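import Literature.Analysis.FluidPDE.FourierL2PicardEnvelope
import HarnessLib

/-!
# Uniform weighted bounds of all orders for the Picard iterates (the `e^{-λt}` method)

Twelfth file of the weighted-`L²` Fourier-side construction of the local smooth solution of the
Navier–Stokes system with `H¹`-controlled lifespan (discharge of
`Literature.Analysis.FluidPDE.tao2011_fourier_local_existence`; Tao 2013, Thm. 5.4 (ii)+(iv)).

Tao (arXiv p. 16): "the estimates for higher `k` follow from variants of the above argument and
an induction on `k`". On the Fourier side we run, for each order `K` separately, the
exponential-time-weight recursion for the Duhamel parts `E_n = h - v_n` of the Picard iterates: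
with the `n`-uniform `λ`-free `L¹ ∩ L²` majorants `G₀ = ∑ⱼ‖aⱼ‖ₑ + 3Ψ_n` of `M_{v_n}`
(`FourierL2PicardEnvelope`) and the master `λ`-step,

  `e^{-λt}(1+‖ξ‖)^K ‖E_{n+1}(t,ξ)‖ₑ ≤ R_{n+1}(ξ) := μ ((G₀ ⋆ₗ G_K) + (G_K ⋆ₗ G₀))(ξ)`,
  `G_K = (1+‖·‖)^K ∑ⱼ‖aⱼ‖ₑ + 3R_n`,  `μ = (2√(cλ))⁻¹ 4π·9·2^K`,

and Young's inequality gives `‖R_{n+1}‖₂² ≤ 4μ²‖G₀‖₁²‖G_K‖₂²`, which closes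
(`‖R_n‖₂² ≤ ∫((1+‖η‖)^K∑ⱼ‖aⱼ‖ₑ)²` for all `n`) once `λ` is large enough, `λ = λ(K, c, T, a)`
(`exists_uniform_weighted_majorant_picardIter`). Cauchy–Schwarz instead of Young then yields
**pointwise polynomial decay of every order, uniformly in `n` and `t`**
(`exists_uniform_hasDecay_picardIter`), the compactness needed to pass to the limit.

## Wide class (forced twin)

Every theorem of this file taking `hEc : Continuous (uncurry E)` has a primed twin taking instead
`(hEm : Measurable (uncurry E))` — joint measurability, which is all the proof uses of the joint
continuity (slice measurability). This is the class of `E = D - F`, `D`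
jointly continuous, `F = ∫₀ᵗ heat(t-s) • b(s) ds` a forcing term whose Leray-projected coefficient
`b` is discontinuous at `ξ = 0` (forced twin `ForcedFourier*`; Tao 2013, Thm. 5.4 is stated and
proved WITH the force). The unprimed theorems are their specialisations.

## References

* T. Tao, Anal. PDE 6 (2013) = arXiv:1108.1165, proof of Thm. 5.1/5.4 (arXiv pp. 16, 18).
  [Tao2011]
-/

noncomputable section

open MeasureTheory Real Set Filter Function intervalIntegral
open scoped ENNReal NNReal
open _root_.Topology

namespace Literature.Analysis.FluidPDE.FourierNS

/-! ### Generic `L²` and sup bounds of the symmetrised majorant convolution -/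

section Generic

variable {ι : Type*} [Fintype ι] {Φ Ψ : EuclideanSpace ℝ ι → ℝ≥0∞}

/-- **Young for the symmetrised convolution**:
`∫⁻ (μ((Ψ ⋆ₗ Φ) + (Φ ⋆ₗ Ψ)))² ≤ μ² · 4 (∫⁻Ψ)² ∫⁻Φ²` (`(x+y)² ≤ 2x²+2y²`, commutativity of
`⋆ₗ`, `lintegral_lconv_sq_le`). [folklore] -/
theorem lintegral_symm_lconv_sq_le (hΦ : AEMeasurable Φ volume) (hΨ : AEMeasurable Ψ volume)
    (μ : ℝ≥0∞) :
    ∫⁻ ξ, (μ * ((Ψ ⋆ₗ Φ) ξ + (Φ ⋆ₗ Ψ) ξ)) ^ 2 ≤ μ ^ 2 * (4 * ((∫⁻ η, Ψ η) ^ 2 * ∫⁻ η, Φ η ^ 2)) := by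
  have hsq : ∀ x y : ℝ≥0∞, (x + y) ^ 2 ≤ 2 * x ^ 2 + 2 * y ^ 2 := fun x y => by
    have h := ENNReal.rpow_add_le_mul_rpow_add_rpow x y (p := 2) (by norm_num)
    norm_num at h
    rw [← mul_add]
    exact_mod_cast h
  have hcomm : (Ψ ⋆ₗ Φ) = (Φ ⋆ₗ Ψ) := lconvolution_comm
  have hY : ∫⁻ ξ, (Φ ⋆ₗ Ψ) ξ ^ 2 ≤ (∫⁻ η, Ψ η) ^ 2 * ∫⁻ η, Φ η ^ 2 := lintegral_lconv_sq_le hΦ hΨ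
  calc ∫⁻ ξ, (μ * ((Ψ ⋆ₗ Φ) ξ + (Φ ⋆ₗ Ψ) ξ)) ^ 2
      = ∫⁻ ξ, μ ^ 2 * ((Φ ⋆ₗ Ψ) ξ + (Φ ⋆ₗ Ψ) ξ) ^ 2 := by simp_rw [hcomm, mul_pow]
    _ ≤ ∫⁻ ξ, μ ^ 2 * (4 * (Φ ⋆ₗ Ψ) ξ ^ 2) := by
        refine lintegral_mono fun ξ => mul_le_mul' le_rfl ((hsq _ _).trans (le_of_eq (by ring)))
    _ = μ ^ 2 * (4 * ∫⁻ ξ, (Φ ⋆ₗ Ψ) ξ ^ 2) := by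
        rw [lintegral_const_mul'' _ (((aemeasurable_lconvolution hΦ hΨ).pow_const 2).const_mul _),
          lintegral_const_mul'' _ ((aemeasurable_lconvolution hΦ hΨ).pow_const 2)]
    _ ≤ μ ^ 2 * (4 * ((∫⁻ η, Ψ η) ^ 2 * ∫⁻ η, Φ η ^ 2)) := by gcongr

/-- **Cauchy–Schwarz for the symmetrised convolution**, pointwise:
`μ((Ψ ⋆ₗ Φ)(ξ) + (Φ ⋆ₗ Ψ)(ξ)) ≤ μ · 2 (∫⁻Ψ²)^{1/2} (∫⁻Φ²)^{1/2}`. [folklore] -/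
theorem symm_lconv_le (hΦ : AEMeasurable Φ volume) (hΨ : AEMeasurable Ψ volume) (μ : ℝ≥0∞)
    (ξ : EuclideanSpace ℝ ι) :
    μ * ((Ψ ⋆ₗ Φ) ξ + (Φ ⋆ₗ Ψ) ξ) ≤
      μ * (2 * ((∫⁻ η, Ψ η ^ 2) ^ (1 / 2 : ℝ) * (∫⁻ η, Φ η ^ 2) ^ (1 / 2 : ℝ))) := by
  refine mul_le_mul' le_rfl ?_
  rw [two_mul]
  refine add_le_add (lconv_le_sqrt_mul_sqrt hΨ hΦ ξ) ?_
  rw [mul_comm]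
  exact lconv_le_sqrt_mul_sqrt hΦ hΨ ξ

/-- `(∫⁻ Θ)` from a weighted square moment: `∫⁻ Θ ≤ (∫⁻ w_m⁻² · S)^{1/2}` whenever
`∫⁻ (w^m Θ)² ≤ S` (`sq_lintegral_le_weight`). [folklore] -/
theorem lintegral_le_rpow_half_of_weight_sq_le (hΦ : AEMeasurable Φ volume) (m : ℕ) {S : ℝ≥0∞}
    (hS : ∫⁻ ξ, (ENNReal.ofReal ((1 + ‖ξ‖) ^ m) * Φ ξ) ^ 2 ≤ S) :
    ∫⁻ ξ, Φ ξ ≤ ((∫⁻ ξ : EuclideanSpace ℝ ι, (ENNReal.ofReal ((1 + ‖ξ‖) ^ m))⁻¹ ^ 2) * S) ^ (1 / 2 : ℝ) := by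
  have hroot : ∀ {x A : ℝ≥0∞}, x ^ 2 ≤ A → x ≤ A ^ (1 / 2 : ℝ) := fun {x A} h =>
    calc x = (x ^ 2) ^ (1 / 2 : ℝ) := by rw [← ENNReal.rpow_natCast, ← ENNReal.rpow_mul]; norm_num
      _ ≤ A ^ (1 / 2 : ℝ) := ENNReal.rpow_le_rpow h (by norm_num)
  exact hroot ((sq_lintegral_le_weight hΦ m).trans (mul_le_mul' le_rfl hS))

end Generic

/-! ### The weighted step for `v = h - E` with envelopes -/

section Step

variable {c T : ℝ} {a : EuclideanSpace ℝ (Fin 3) → Fin 3 → ℂ}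
  {E : ℝ → EuclideanSpace ℝ (Fin 3) → Fin 3 → ℂ}

/-- **The weighted step.** Let `v = h - E` with `E` jointly continuous, `c, λ > 0`, and suppose
on `[0, T]` the `λ`-free envelope `‖E(s, η)‖ₑ ≤ Ψ(η)` and the weighted envelope
`e^{-λs}(1+‖η‖)^K ‖E(s, η)‖ₑ ≤ R(η)`. Then for `t ∈ [0, T]` and every `ξ`,

  `e^{-λt}(1+‖ξ‖)^K ‖duhamelIntegral c T v t ξ‖ₑ ≤ (2√(cλ))⁻¹ C_N 2^K ((G₀ ⋆ₗ G_K)(ξ) + (G_K ⋆ₗ G₀)(ξ))`,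

`G₀ = ∑ⱼ‖aⱼ‖ₑ + 3Ψ`, `G_K = (1+‖·‖)^K ∑ⱼ‖aⱼ‖ₑ + 3R` (`M_v ≤ ∑ⱼ‖aⱼ‖ₑ + 3‖E‖ₑ`, `|heat| ≤ 1`,
`e^{-λs} ≤ 1`, and `exp_mul_weight_mul_enorm_bilinDuhamel_le`). [cite: Tao2011, Thm. 5.4 (ii) WITH force (arXiv:1108.1165 Thm. 31 (ii), p. 18);
proof of Thm. 5.1 (arXiv Thm. 28, p. 16); Lemma 2.1 = arXiv Lemma 23] -/
theorem exp_weight_enorm_duhamelIntegral_hsub_le' (hc : 0 < c) (ha : AEStronglyMeasurable a volume)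
    (hEm : Measurable (uncurry E)) (K : ℕ) {lam : ℝ} (hlam : 0 < lam)
    {Ψ R : EuclideanSpace ℝ (Fin 3) → ℝ≥0∞}
    (hΨ : ∀ s ∈ Icc 0 T, ∀ η, ‖E s η‖ₑ ≤ Ψ η)
    (hR : ∀ s ∈ Icc 0 T, ∀ η, ENNReal.ofReal (Real.exp (-lam * s) * (1 + ‖η‖) ^ K) * ‖E s η‖ₑ ≤ R η)
    {t : ℝ} (ht : t ∈ Icc 0 T) (ξ : EuclideanSpace ℝ (Fin 3)) :
    ENNReal.ofReal (Real.exp (-lam * t) * (1 + ‖ξ‖) ^ K) *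
        ‖duhamelIntegral c T (fun s ζ => heat c ζ (clamp T s) • a ζ - E s ζ) t ξ‖ₑ ≤
      ENNReal.ofReal (1 / (2 * Real.sqrt (c * lam))) * (ENNReal.ofReal (4 * π) *
        (Fintype.card (Fin 3) : ℝ≥0∞) ^ 2 * 2 ^ K *
        (((fun η => (∑ j, ‖a η j‖ₑ) + 3 * Ψ η) ⋆ₗ
            (fun η => ENNReal.ofReal ((1 + ‖η‖) ^ K) * (∑ j, ‖a η j‖ₑ) + 3 * R η)) ξ +
          ((fun η => ENNReal.ofReal ((1 + ‖η‖) ^ K) * (∑ j, ‖a η j‖ₑ) + 3 * R η) ⋆ₗ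
            (fun η => (∑ j, ‖a η j‖ₑ) + 3 * Ψ η)) ξ)) := by
  set v : ℝ → EuclideanSpace ℝ (Fin 3) → Fin 3 → ℂ := fun s ζ => heat c ζ (clamp T s) • a ζ - E s ζ with hv
  have hvm : ∀ s, AEStronglyMeasurable (v s) volume := aestronglyMeasurable_hsub_slice' c T a E ha hEm
  have h3 : (Fintype.card (Fin 3) : ℝ≥0∞) = 3 := by simp
  -- the majorant of `v s` against the envelopes
  have hMv : ∀ s η, (∑ j, ‖v s η j‖ₑ) ≤ (∑ j, ‖a η j‖ₑ) + ∑ j, ‖E s η j‖ₑ := by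
    intro s η
    rw [← Finset.sum_add_distrib]
    refine Finset.sum_le_sum fun j _ => ?_
    simp only [hv, Pi.sub_apply]
    exact (enorm_sub_le).trans (add_le_add (enorm_heat_smul_apply_le hc.le s η j) le_rfl)
  have hME : ∀ s η, (∑ j, ‖E s η j‖ₑ) ≤ 3 * ‖E s η‖ₑ := fun s η => by
    simpa only [h3] using majorant_le_card_mul_enorm (E s η)
  have hG₀ : ∀ s ∈ Icc 0 T, ∀ η, (∑ j, ‖v s η j‖ₑ) ≤ (∑ j, ‖a η j‖ₑ) + 3 * Ψ η := fun s hs η =>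
    (hMv s η).trans (add_le_add le_rfl ((hME s η).trans (mul_le_mul' le_rfl (hΨ s hs η))))
  have hGk : ∀ s ∈ Icc 0 T, ∀ η, ENNReal.ofReal (Real.exp (-lam * s) * (1 + ‖η‖) ^ K) *
      (∑ j, ‖v s η j‖ₑ) ≤ ENNReal.ofReal ((1 + ‖η‖) ^ K) * (∑ j, ‖a η j‖ₑ) + 3 * R η := by
    intro s hs η
    have hE0 : 0 ≤ Real.exp (-lam * s) := (Real.exp_pos _).le
    have hE1 : Real.exp (-lam * s) ≤ 1 := by
      rw [Real.exp_le_one_iff]; nlinarith [hs.1]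
    have hw0 : (0 : ℝ) ≤ (1 + ‖η‖) ^ K := by positivity
    calc ENNReal.ofReal (Real.exp (-lam * s) * (1 + ‖η‖) ^ K) * (∑ j, ‖v s η j‖ₑ)
        ≤ ENNReal.ofReal (Real.exp (-lam * s) * (1 + ‖η‖) ^ K) * ((∑ j, ‖a η j‖ₑ) + ∑ j, ‖E s η j‖ₑ) :=
          mul_le_mul' le_rfl (hMv s η)
      _ = ENNReal.ofReal (Real.exp (-lam * s) * (1 + ‖η‖) ^ K) * (∑ j, ‖a η j‖ₑ) +
          ENNReal.ofReal (Real.exp (-lam * s) * (1 + ‖η‖) ^ K) * ∑ j, ‖E s η j‖ₑ := mul_add _ _ _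
      _ ≤ ENNReal.ofReal ((1 + ‖η‖) ^ K) * (∑ j, ‖a η j‖ₑ) +
          ENNReal.ofReal (Real.exp (-lam * s) * (1 + ‖η‖) ^ K) * (3 * ‖E s η‖ₑ) := by
          refine add_le_add (mul_le_mul' (ENNReal.ofReal_le_ofReal ?_) le_rfl) (mul_le_mul' le_rfl (hME s η))
          exact mul_le_of_le_one_left hw0 hE1
      _ = ENNReal.ofReal ((1 + ‖η‖) ^ K) * (∑ j, ‖a η j‖ₑ) +
          3 * (ENNReal.ofReal (Real.exp (-lam * s) * (1 + ‖η‖) ^ K) * ‖E s η‖ₑ) := by ring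
      _ ≤ _ := add_le_add le_rfl (mul_le_mul' le_rfl (hR s hs η))
  have h := exp_mul_weight_mul_enorm_bilinDuhamel_le (T := T) hc hlam hvm hvm K hG₀ hGk hG₀ hGk ht ξ
  rw [ENNReal.ofReal_mul (Real.exp_pos _).le, mul_assoc]
  unfold duhamelIntegral
  rw [clamp_of_mem ht]
  exact h

/-- **The weighted step.** Let `v = h - E` with `E` jointly continuous, `c, λ > 0`, and suppose
on `[0, T]` the `λ`-free envelope `‖E(s, η)‖ₑ ≤ Ψ(η)` and the weighted envelope
`e^{-λs}(1+‖η‖)^K ‖E(s, η)‖ₑ ≤ R(η)`. Then for `t ∈ [0, T]` and every `ξ`,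

  `e^{-λt}(1+‖ξ‖)^K ‖duhamelIntegral c T v t ξ‖ₑ ≤ (2√(cλ))⁻¹ C_N 2^K ((G₀ ⋆ₗ G_K)(ξ) + (G_K ⋆ₗ G₀)(ξ))`,

`G₀ = ∑ⱼ‖aⱼ‖ₑ + 3Ψ`, `G_K = (1+‖·‖)^K ∑ⱼ‖aⱼ‖ₑ + 3R` (`M_v ≤ ∑ⱼ‖aⱼ‖ₑ + 3‖E‖ₑ`, `|heat| ≤ 1`,
`e^{-λs} ≤ 1`, and `exp_mul_weight_mul_enorm_bilinDuhamel_le`). [folklore] -/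
theorem exp_weight_enorm_duhamelIntegral_hsub_le (hc : 0 < c) (ha : AEStronglyMeasurable a volume)
    (hEc : Continuous (uncurry E)) (K : ℕ) {lam : ℝ} (hlam : 0 < lam)
    {Ψ R : EuclideanSpace ℝ (Fin 3) → ℝ≥0∞}
    (hΨ : ∀ s ∈ Icc 0 T, ∀ η, ‖E s η‖ₑ ≤ Ψ η)
    (hR : ∀ s ∈ Icc 0 T, ∀ η, ENNReal.ofReal (Real.exp (-lam * s) * (1 + ‖η‖) ^ K) * ‖E s η‖ₑ ≤ R η)
    {t : ℝ} (ht : t ∈ Icc 0 T) (ξ : EuclideanSpace ℝ (Fin 3)) :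
    ENNReal.ofReal (Real.exp (-lam * t) * (1 + ‖ξ‖) ^ K) *
        ‖duhamelIntegral c T (fun s ζ => heat c ζ (clamp T s) • a ζ - E s ζ) t ξ‖ₑ ≤
      ENNReal.ofReal (1 / (2 * Real.sqrt (c * lam))) * (ENNReal.ofReal (4 * π) *
        (Fintype.card (Fin 3) : ℝ≥0∞) ^ 2 * 2 ^ K *
        (((fun η => (∑ j, ‖a η j‖ₑ) + 3 * Ψ η) ⋆ₗ
            (fun η => ENNReal.ofReal ((1 + ‖η‖) ^ K) * (∑ j, ‖a η j‖ₑ) + 3 * R η)) ξ +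
          ((fun η => ENNReal.ofReal ((1 + ‖η‖) ^ K) * (∑ j, ‖a η j‖ₑ) + 3 * R η) ⋆ₗ
            (fun η => (∑ j, ‖a η j‖ₑ) + 3 * Ψ η)) ξ)) :=
  exp_weight_enorm_duhamelIntegral_hsub_le' hc ha hEc.measurable K hlam hΨ hR ht ξ

end Step

/-! ### The recursion: uniform weighted `L²` majorants of all orders -/

section Iteration

variable {c T : ℝ} {a : EuclideanSpace ℝ (Fin 3) → Fin 3 → ℂ}

/-- **Uniform weighted majorants of the Duhamel parts of the Picard iterates, every order.**
Under the hypotheses of `picard_uniform_bounds` and for every `K`, there are `λ > 0` and a finite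
`β` such that every `E_n = h - picardIter c T a n` admits a measurable `R_n` with
`∫⁻ R_n² ≤ β` and `e^{-λt}(1+‖ξ‖)^K ‖E_n(t, ξ)‖ₑ ≤ R_n(ξ)` for `t ∈ [0, T]`
(`R_0 = 0`, `R_{n+1} = μ((G₀ ⋆ₗ G_K) + (G_K ⋆ₗ G₀))`, Young, and the choice
`λ = 20 (C_N 2^K γ)²/c + 1`, `γ ≥ ‖G₀‖_{L¹}` uniformly, `β = ∫⁻((1+‖η‖)^K∑ⱼ‖aⱼ‖ₑ)²`).
This is the `L^∞_t H^K_x`-type bound of Tao's Thm. 5.4 (ii) ("`‖u‖_{X^k} ≲_{k,…} 1`") for the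
approximating sequence, in exponentially time-weighted form. [cite: Tao2011, Thm. 5.4 (ii)
(arXiv Thm. 31), proof of Thm. 5.1 (arXiv Thm. 28, p. 16)] -/
theorem exists_uniform_weighted_majorant_picardIter (hc : 0 < c) (hT : 0 ≤ T)
    (ha : AEStronglyMeasurable a volume)
    (haw : ∀ (k : ℕ) j, ∫⁻ η, (ENNReal.ofReal ((1 + ‖η‖) ^ k) * ‖a η j‖ₑ) ^ 2 < ⊤)
    (hs : 2304 * (ENNReal.ofReal (4 * π) * (Fintype.card (Fin 3) : ℝ≥0∞) ^ 2) ^ 2 *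
        ((SNormLESNormFDerivOfEqConst ℂ (volume : Measure (EuclideanSpace ℝ (Fin 3))) 2 *
          ENNReal.ofReal (2 * π)) ^ (3 / 2 : ℝ)) ^ 2 * ENNReal.ofReal c⁻¹ *
        (ENNReal.ofReal T * ENNReal.ofReal (2 / c)) ^ (1 / 2 : ℝ) *
        (∫⁻ η, (ENNReal.ofReal ‖η‖ * ∑ j, ‖a η j‖ₑ) ^ 2) ≤ 1) (K : ℕ) :
    ∃ lam : ℝ, 0 < lam ∧ ∃ β : ℝ≥0∞, β < ⊤ ∧ ∀ n : ℕ,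
      ∃ R : EuclideanSpace ℝ (Fin 3) → ℝ≥0∞, AEMeasurable R volume ∧ ∫⁻ ξ, R ξ ^ 2 ≤ β ∧
        ∀ t ∈ Icc 0 T, ∀ ξ, ENNReal.ofReal (Real.exp (-lam * t) * (1 + ‖ξ‖) ^ K) *
          ‖heat c ξ (clamp T t) • a ξ - picardIter c T a n t ξ‖ₑ ≤ R ξ := by
  obtain ⟨Λ, hΛ, hΨ⟩ := exists_uniform_envelope_picardIter hc hT ha haw hs
  set C : ℝ≥0∞ := ENNReal.ofReal (4 * π) * (Fintype.card (Fin 3) : ℝ≥0∞) ^ 2 with hC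
  have hCtop : C < ⊤ := ENNReal.mul_lt_top ENNReal.ofReal_lt_top (by simp)
  set Amaj : EuclideanSpace ℝ (Fin 3) → ℝ≥0∞ := fun η => ∑ j, ‖a η j‖ₑ with hAmaj
  have hAm : AEMeasurable Amaj volume := aemeasurable_majorant ha
  -- data constants
  set W2 : ℝ≥0∞ := ∫⁻ ξ : EuclideanSpace ℝ (Fin 3), (ENNReal.ofReal ((1 + ‖ξ‖) ^ 2))⁻¹ ^ 2 with hW2
  have hW2top : W2 < ⊤ := lintegral_weight_inv_sq_lt_top finrank_three_lt_four
  set αw2 : ℝ≥0∞ := ∫⁻ η, (ENNReal.ofReal ((1 + ‖η‖) ^ 2) * Amaj η) ^ 2 with hαw2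
  set αwK : ℝ≥0∞ := ∫⁻ η, (ENNReal.ofReal ((1 + ‖η‖) ^ K) * Amaj η) ^ 2 with hαwK
  have hαwKtop : αwK < ⊤ := lintegral_weight_majorant_sq_lt_top ha K (haw K)
  have hrt : ∀ {x : ℝ≥0∞}, x < ⊤ → x ^ (1 / 2 : ℝ) < ⊤ := fun h =>
    ENNReal.rpow_lt_top_of_nonneg (by norm_num) h.ne
  -- the uniform `L¹` bound of `G₀ = Amaj + 3Ψ`
  set γ : ℝ≥0∞ := (W2 * αw2) ^ (1 / 2 : ℝ) + 3 * (W2 * Λ) ^ (1 / 2 : ℝ) with hγ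
  have hγtop : γ < ⊤ :=
    ENNReal.add_lt_top.2 ⟨hrt (ENNReal.mul_lt_top hW2top (lintegral_weight_majorant_sq_lt_top ha 2 (haw 2))),
      ENNReal.mul_lt_top (by norm_num) (hrt (ENNReal.mul_lt_top hW2top hΛ))⟩
  have hG₀L1 : ∀ {Ψ : EuclideanSpace ℝ (Fin 3) → ℝ≥0∞}, Measurable Ψ →
      ∫⁻ η, (ENNReal.ofReal ((1 + ‖η‖) ^ 2) * Ψ η) ^ 2 ≤ Λ → ∫⁻ η, (Amaj η + 3 * Ψ η) ≤ γ := by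
    intro Ψ hΨm hΨΛ
    rw [lintegral_add_left' hAm, lintegral_const_mul' _ _ (by norm_num)]
    exact add_le_add (lintegral_le_rpow_half_of_weight_sq_le hAm 2 le_rfl)
      (mul_le_mul' le_rfl (lintegral_le_rpow_half_of_weight_sq_le hΨm.aemeasurable 2 hΨΛ))
  -- the choice of `λ`
  set X : ℝ≥0∞ := (C * 2 ^ K) ^ 2 * γ ^ 2 with hX
  have hXtop : X < ⊤ := ENNReal.mul_lt_top (ENNReal.pow_lt_top (ENNReal.mul_lt_top hCtop
    (ENNReal.pow_lt_top (by simp)))) (ENNReal.pow_lt_top hγtop)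
  set lam : ℝ := 20 * X.toReal / c + 1 with hlam
  have hlam0 : 0 < lam := by positivity
  set μ : ℝ≥0∞ := ENNReal.ofReal (1 / (2 * Real.sqrt (c * lam))) * (C * 2 ^ K) with hμ
  have hkey : 80 * (μ ^ 2 * γ ^ 2) ≤ 1 := by
    have hsq : ENNReal.ofReal (1 / (2 * Real.sqrt (c * lam))) ^ 2 = ENNReal.ofReal (1 / (4 * (c * lam))) := by
      rw [← ENNReal.ofReal_pow (by positivity), div_pow, mul_pow, Real.sq_sqrt (by positivity)]
      norm_num
    have h1 : μ ^ 2 * γ ^ 2 = ENNReal.ofReal (1 / (4 * (c * lam))) * X := by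
      rw [hμ, mul_pow, hsq, hX]; ring
    have h2 : (80 : ℝ≥0∞) * ENNReal.ofReal (1 / (4 * (c * lam))) = ENNReal.ofReal (20 / (c * lam)) := by
      rw [show (80 : ℝ≥0∞) = ENNReal.ofReal 80 by norm_num, ← ENNReal.ofReal_mul (by norm_num)]
      congr 1
      field_simp
      norm_num
    have hcl : c * lam = 20 * X.toReal + c := by rw [hlam]; field_simp
    calc 80 * (μ ^ 2 * γ ^ 2) = ENNReal.ofReal (20 / (c * lam)) * X := by rw [h1, ← mul_assoc, h2]
      _ = ENNReal.ofReal (20 / (c * lam) * X.toReal) := by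
          rw [ENNReal.ofReal_mul (by positivity), ENNReal.ofReal_toReal hXtop.ne]
      _ ≤ ENNReal.ofReal 1 := by
          refine ENNReal.ofReal_le_ofReal ?_
          rw [div_mul_eq_mul_div, div_le_one (by positivity), hcl]
          linarith
      _ = 1 := ENNReal.ofReal_one
  refine ⟨lam, hlam0, αwK, hαwKtop, fun n => ?_⟩
  induction n with
  | zero =>
    refine ⟨fun _ => 0, aemeasurable_const, by simp, fun t _ ξ => ?_⟩
    simp [picardIter]
  | succ n ih =>
    obtain ⟨R, hRm, hRβ, hR⟩ := ih
    obtain ⟨Ψ, hΨm, hΨb, hΨΛ⟩ := hΨ n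
    set En : ℝ → EuclideanSpace ℝ (Fin 3) → Fin 3 → ℂ :=
      fun t ξ => heat c ξ (clamp T t) • a ξ - picardIter c T a n t ξ with hEn
    have hvn : (fun s η => heat c η (clamp T s) • a η - En s η) = picardIter c T a n := by
      funext s η; simp [hEn]
    have hstep : ∀ t ξ, heat c ξ (clamp T t) • a ξ - picardIter c T a (n + 1) t ξ =
        duhamelIntegral c T (fun s η => heat c η (clamp T s) • a η - En s η) t ξ := by
      intro t ξ
      rw [hvn, picardIter, duhamel_eq, sub_sub_cancel]
    obtain ⟨hEc, -⟩ := class_picardIter hc.le hT ha haw n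
    set G₀ : EuclideanSpace ℝ (Fin 3) → ℝ≥0∞ := fun η => Amaj η + 3 * Ψ η with hG₀
    set GK : EuclideanSpace ℝ (Fin 3) → ℝ≥0∞ :=
      fun η => ENNReal.ofReal ((1 + ‖η‖) ^ K) * Amaj η + 3 * R η with hGK
    have hG₀m : AEMeasurable G₀ volume := hAm.add (hΨm.aemeasurable.const_mul _)
    have hGKm : AEMeasurable GK volume :=
      ((measurable_ofReal_weight K).aemeasurable.mul hAm).add (hRm.const_mul _)
    have hsq : ∀ x y : ℝ≥0∞, (x + y) ^ 2 ≤ 2 * x ^ 2 + 2 * y ^ 2 := fun x y => by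
      have h := ENNReal.rpow_add_le_mul_rpow_add_rpow x y (p := 2) (by norm_num)
      norm_num at h
      rw [← mul_add]
      exact_mod_cast h
    have hGK2 : ∫⁻ η, GK η ^ 2 ≤ 20 * αwK := by
      calc ∫⁻ η, GK η ^ 2 ≤ ∫⁻ η, (2 * (ENNReal.ofReal ((1 + ‖η‖) ^ K) * Amaj η) ^ 2 + 2 * (3 * R η) ^ 2) :=
            lintegral_mono fun η => hsq _ _
        _ = 2 * αwK + 18 * ∫⁻ η, R η ^ 2 := by
            rw [lintegral_add_left' (f := fun η => 2 * (ENNReal.ofReal ((1 + ‖η‖) ^ K) * Amaj η) ^ 2)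
              ((((measurable_ofReal_weight K).aemeasurable.mul hAm).pow_const 2).const_mul _),
              lintegral_const_mul' _ _ (by norm_num), ← hαwK]
            have h9 : ∀ η, 2 * (3 * R η) ^ 2 = 18 * R η ^ 2 := fun η => by ring
            simp_rw [h9]
            rw [lintegral_const_mul' _ _ (by norm_num)]
        _ ≤ 2 * αwK + 18 * αwK := add_le_add le_rfl (mul_le_mul' le_rfl hRβ)
        _ = 20 * αwK := by ring
    refine ⟨fun ξ => μ * ((G₀ ⋆ₗ GK) ξ + (GK ⋆ₗ G₀) ξ), ?_, ?_, fun t ht ξ => ?_⟩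
    · exact ((aemeasurable_lconvolution hG₀m hGKm).add (aemeasurable_lconvolution hGKm hG₀m)).const_mul μ
    · calc ∫⁻ ξ, (μ * ((G₀ ⋆ₗ GK) ξ + (GK ⋆ₗ G₀) ξ)) ^ 2
          ≤ μ ^ 2 * (4 * ((∫⁻ η, G₀ η) ^ 2 * ∫⁻ η, GK η ^ 2)) := lintegral_symm_lconv_sq_le hGKm hG₀m μ
        _ ≤ μ ^ 2 * (4 * (γ ^ 2 * (20 * αwK))) := by
            gcongr
            · exact hG₀L1 hΨm hΨΛ
        _ = 80 * (μ ^ 2 * γ ^ 2) * αwK := by ring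
        _ ≤ 1 * αwK := mul_le_mul' hkey le_rfl
        _ = αwK := one_mul _
    · rw [hstep]
      have hΨ' : ∀ s ∈ Icc 0 T, ∀ η, ‖En s η‖ₑ ≤ Ψ η := fun s _ η => hΨb s η
      have h := exp_weight_enorm_duhamelIntegral_hsub_le (T := T) hc ha hEc K hlam0 hΨ' hR ht ξ
      refine h.trans (le_of_eq ?_)
      simp only [hμ, hG₀, hGK, hAmaj, hC]
      ring


/-- **Pointwise polynomial decay of every order, uniformly along the Picard iteration.** Under
the hypotheses of `picard_uniform_bounds`, for every `K` there is `B` with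
`HasDecay K B (E_n t)` for **all** `n` and all `t ∈ ℝ` (`E_n = h - picardIter c T a n`;
Cauchy–Schwarz on `R_{n+1} = μ((G₀ ⋆ₗ G_K) + (G_K ⋆ₗ G₀))` with the uniform `L²` bounds of
`G₀`, `G_K`, and `e^{λt} ≤ e^{λT}`; times outside `[0, T]` through the clamped time).
[cite: Tao2011, Thm. 5.4 (ii)+(iv) (arXiv Thm. 31)] -/
theorem exists_uniform_hasDecay_picardIter (hc : 0 < c) (hT : 0 ≤ T)
    (ha : AEStronglyMeasurable a volume)
    (haw : ∀ (k : ℕ) j, ∫⁻ η, (ENNReal.ofReal ((1 + ‖η‖) ^ k) * ‖a η j‖ₑ) ^ 2 < ⊤)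
    (hs : 2304 * (ENNReal.ofReal (4 * π) * (Fintype.card (Fin 3) : ℝ≥0∞) ^ 2) ^ 2 *
        ((SNormLESNormFDerivOfEqConst ℂ (volume : Measure (EuclideanSpace ℝ (Fin 3))) 2 *
          ENNReal.ofReal (2 * π)) ^ (3 / 2 : ℝ)) ^ 2 * ENNReal.ofReal c⁻¹ *
        (ENNReal.ofReal T * ENNReal.ofReal (2 / c)) ^ (1 / 2 : ℝ) *
        (∫⁻ η, (ENNReal.ofReal ‖η‖ * ∑ j, ‖a η j‖ₑ) ^ 2) ≤ 1) (K : ℕ) :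
    ∃ B : ℝ, ∀ n t, HasDecay K B (fun ξ => heat c ξ (clamp T t) • a ξ - picardIter c T a n t ξ) := by
  obtain ⟨Λ, hΛ, hΨ⟩ := exists_uniform_envelope_picardIter hc hT ha haw hs
  obtain ⟨lam, hlam, β, hβ, hR⟩ := exists_uniform_weighted_majorant_picardIter hc hT ha haw hs K
  set C : ℝ≥0∞ := ENNReal.ofReal (4 * π) * (Fintype.card (Fin 3) : ℝ≥0∞) ^ 2 with hC
  have hCtop : C < ⊤ := ENNReal.mul_lt_top ENNReal.ofReal_lt_top (by simp)
  set Amaj : EuclideanSpace ℝ (Fin 3) → ℝ≥0∞ := fun η => ∑ j, ‖a η j‖ₑ with hAmaj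
  have hAm : AEMeasurable Amaj volume := aemeasurable_majorant ha
  set αw0 : ℝ≥0∞ := ∫⁻ η, Amaj η ^ 2 with hαw0
  have hαw0top : αw0 < ⊤ := by
    have h := lintegral_weight_majorant_sq_lt_top ha 0 (haw 0)
    simpa using h
  set αwK : ℝ≥0∞ := ∫⁻ η, (ENNReal.ofReal ((1 + ‖η‖) ^ K) * Amaj η) ^ 2 with hαwK
  have hαwKtop : αwK < ⊤ := lintegral_weight_majorant_sq_lt_top ha K (haw K)
  have hrt : ∀ {x : ℝ≥0∞}, x < ⊤ → x ^ (1 / 2 : ℝ) < ⊤ := fun h =>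
    ENNReal.rpow_lt_top_of_nonneg (by norm_num) h.ne
  set μ : ℝ≥0∞ := ENNReal.ofReal (1 / (2 * Real.sqrt (c * lam))) * (C * 2 ^ K) with hμ
  have hμtop : μ < ⊤ := ENNReal.mul_lt_top ENNReal.ofReal_lt_top
    (ENNReal.mul_lt_top hCtop (ENNReal.pow_lt_top (by simp)))
  set b : ℝ≥0∞ := μ * (2 * ((2 * αw0 + 18 * Λ) ^ (1 / 2 : ℝ) * (2 * αwK + 18 * β) ^ (1 / 2 : ℝ))) with hb
  have hbtop : b < ⊤ := by
    refine ENNReal.mul_lt_top hμtop (ENNReal.mul_lt_top (by norm_num) (ENNReal.mul_lt_top ?_ ?_))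
    · exact hrt (ENNReal.add_lt_top.2 ⟨ENNReal.mul_lt_top (by norm_num) hαw0top,
        ENNReal.mul_lt_top (by norm_num) hΛ⟩)
    · exact hrt (ENNReal.add_lt_top.2 ⟨ENNReal.mul_lt_top (by norm_num) hαwKtop,
        ENNReal.mul_lt_top (by norm_num) hβ⟩)
  set b' : ℝ≥0∞ := ENNReal.ofReal (Real.exp (lam * T)) * b with hb'
  have hb'top : b' ≠ ⊤ := ENNReal.mul_ne_top ENNReal.ofReal_ne_top hbtop.ne
  refine ⟨b'.toReal, fun n t => ?_⟩
  cases n with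
  | zero =>
    intro ξ
    simp only [picardIter, sub_self, norm_zero]
    positivity
  | succ n =>
    obtain ⟨R, hRm, hRβ, hRb⟩ := hR n
    obtain ⟨Ψ, hΨm, hΨb, hΨΛ⟩ := hΨ n
    set En : ℝ → EuclideanSpace ℝ (Fin 3) → Fin 3 → ℂ :=
      fun t ξ => heat c ξ (clamp T t) • a ξ - picardIter c T a n t ξ with hEn
    have hvn : (fun s η => heat c η (clamp T s) • a η - En s η) = picardIter c T a n := by
      funext s η; simp [hEn]
    have hstep : ∀ t ξ, heat c ξ (clamp T t) • a ξ - picardIter c T a (n + 1) t ξ =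
        duhamelIntegral c T (fun s η => heat c η (clamp T s) • a η - En s η) (clamp T t) ξ := by
      intro t ξ
      rw [hvn, picardIter, duhamel_eq, sub_sub_cancel]
      simp only [duhamelIntegral, clamp_clamp hT]
    obtain ⟨hEc, -⟩ := class_picardIter hc.le hT ha haw n
    set G₀ : EuclideanSpace ℝ (Fin 3) → ℝ≥0∞ := fun η => Amaj η + 3 * Ψ η with hG₀
    set GK : EuclideanSpace ℝ (Fin 3) → ℝ≥0∞ :=
      fun η => ENNReal.ofReal ((1 + ‖η‖) ^ K) * Amaj η + 3 * R η with hGK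
    have hG₀m : AEMeasurable G₀ volume := hAm.add (hΨm.aemeasurable.const_mul _)
    have hGKm : AEMeasurable GK volume :=
      ((measurable_ofReal_weight K).aemeasurable.mul hAm).add (hRm.const_mul _)
    have hsq : ∀ x y : ℝ≥0∞, (x + y) ^ 2 ≤ 2 * x ^ 2 + 2 * y ^ 2 := fun x y => by
      have h := ENNReal.rpow_add_le_mul_rpow_add_rpow x y (p := 2) (by norm_num)
      norm_num at h
      rw [← mul_add]
      exact_mod_cast h
    have hG₀2 : ∫⁻ η, G₀ η ^ 2 ≤ 2 * αw0 + 18 * Λ := by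
      calc ∫⁻ η, G₀ η ^ 2 ≤ ∫⁻ η, (2 * Amaj η ^ 2 + 2 * (3 * Ψ η) ^ 2) := lintegral_mono fun η => hsq _ _
        _ = 2 * αw0 + 18 * ∫⁻ η, Ψ η ^ 2 := by
            rw [lintegral_add_left' (f := fun η => 2 * Amaj η ^ 2) ((hAm.pow_const 2).const_mul _),
              lintegral_const_mul' _ _ (by norm_num), ← hαw0]
            have h9 : ∀ η, 2 * (3 * Ψ η) ^ 2 = 18 * Ψ η ^ 2 := fun η => by ring
            simp_rw [h9]
            rw [lintegral_const_mul' _ _ (by norm_num)]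
        _ ≤ 2 * αw0 + 18 * Λ := by
            refine add_le_add le_rfl (mul_le_mul' le_rfl ((lintegral_mono fun η => ?_).trans hΨΛ))
            rw [mul_pow]
            calc Ψ η ^ 2 = 1 * Ψ η ^ 2 := (one_mul _).symm
              _ ≤ ENNReal.ofReal ((1 + ‖η‖) ^ 2) ^ 2 * Ψ η ^ 2 :=
                  mul_le_mul' (one_le_pow₀ (one_le_ofReal_weight 2 η)) le_rfl
    have hGK2 : ∫⁻ η, GK η ^ 2 ≤ 2 * αwK + 18 * β := by
      calc ∫⁻ η, GK η ^ 2 ≤ ∫⁻ η, (2 * (ENNReal.ofReal ((1 + ‖η‖) ^ K) * Amaj η) ^ 2 + 2 * (3 * R η) ^ 2) :=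
            lintegral_mono fun η => hsq _ _
        _ = 2 * αwK + 18 * ∫⁻ η, R η ^ 2 := by
            rw [lintegral_add_left' (f := fun η => 2 * (ENNReal.ofReal ((1 + ‖η‖) ^ K) * Amaj η) ^ 2)
              ((((measurable_ofReal_weight K).aemeasurable.mul hAm).pow_const 2).const_mul _),
              lintegral_const_mul' _ _ (by norm_num), ← hαwK]
            have h9 : ∀ η, 2 * (3 * R η) ^ 2 = 18 * R η ^ 2 := fun η => by ring
            simp_rw [h9]
            rw [lintegral_const_mul' _ _ (by norm_num)]
        _ ≤ 2 * αwK + 18 * β := add_le_add le_rfl (mul_le_mul' le_rfl hRβ)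
    refine hasDecay_of_weight_mul_enorm_le hb'top fun ξ => ?_
    have ht' : clamp T t ∈ Icc 0 T := clamp_mem_Icc hT t
    have hΨ' : ∀ s ∈ Icc 0 T, ∀ η, ‖En s η‖ₑ ≤ Ψ η := fun s _ η => hΨb s η
    have hmain := exp_weight_enorm_duhamelIntegral_hsub_le (T := T) hc ha hEc K hlam hΨ' hRb ht' ξ
    have h2 : ENNReal.ofReal (1 / (2 * Real.sqrt (c * lam))) * (ENNReal.ofReal (4 * π) *
        (Fintype.card (Fin 3) : ℝ≥0∞) ^ 2 * 2 ^ K * ((G₀ ⋆ₗ GK) ξ + (GK ⋆ₗ G₀) ξ)) ≤ b := by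
      calc _ = μ * ((G₀ ⋆ₗ GK) ξ + (GK ⋆ₗ G₀) ξ) := by simp only [hμ, hC]; ring
        _ ≤ μ * (2 * ((∫⁻ η, G₀ η ^ 2) ^ (1 / 2 : ℝ) * (∫⁻ η, GK η ^ 2) ^ (1 / 2 : ℝ))) :=
            symm_lconv_le hGKm hG₀m μ ξ
        _ ≤ b := mul_le_mul' le_rfl (mul_le_mul' le_rfl (mul_le_mul'
            (ENNReal.rpow_le_rpow hG₀2 (by norm_num)) (ENNReal.rpow_le_rpow hGK2 (by norm_num))))
    have hexp : ENNReal.ofReal ((1 + ‖ξ‖) ^ K) = ENNReal.ofReal (Real.exp (lam * clamp T t)) *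
        ENNReal.ofReal (Real.exp (-lam * clamp T t) * (1 + ‖ξ‖) ^ K) := by
      rw [← ENNReal.ofReal_mul (Real.exp_pos _).le, ← mul_assoc, ← Real.exp_add]
      congr 1
      rw [show lam * clamp T t + -lam * clamp T t = 0 by ring, Real.exp_zero, one_mul]
    calc ENNReal.ofReal ((1 + ‖ξ‖) ^ K) * ‖heat c ξ (clamp T t) • a ξ - picardIter c T a (n + 1) t ξ‖ₑ
        = ENNReal.ofReal (Real.exp (lam * clamp T t)) *
            (ENNReal.ofReal (Real.exp (-lam * clamp T t) * (1 + ‖ξ‖) ^ K) *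
              ‖duhamelIntegral c T (fun s η => heat c η (clamp T s) • a η - En s η) (clamp T t) ξ‖ₑ) := by
          rw [hstep, hexp, mul_assoc]
      _ ≤ ENNReal.ofReal (Real.exp (lam * clamp T t)) * b := mul_le_mul' le_rfl (hmain.trans h2)
      _ ≤ ENNReal.ofReal (Real.exp (lam * T)) * b := by
          refine mul_le_mul' (ENNReal.ofReal_le_ofReal (Real.exp_le_exp.2 ?_)) le_rfl
          exact mul_le_mul_of_nonneg_left ht'.2 hlam.le

end Iteration

end Literature.Analysis.FluidPDE.FourierNS

end
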